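import Literature.NumberTheory.Automorphic.IwahoriGL
import Literature.NumberTheory.Automorphic.HeckePairCongruenceSubgroups
import HarnessLib

/-!
# Hecke pairs `(GL_n(F), P)` for the parahoric, Iwahori, pro-unipotent and principal congruence subgroups of `GL_n(𝒪)`
# over any field whose valuation ring is a DVR with finite residue field (Iwahori–Matsumoto 1965, §3; Shimura §3.1–3.2)

Topic `NumberTheory/Automorphic`; namespace `Literature.NumberTheory.Automorphic` (lane `lit-hodgefound`, Track 2
foundations; seat `lit-hodgefound-p11`, generation 38, row g38-#7).  THEOREMS ONLY: no definition, no named fact, no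
instance, no notation.  Sequel of `HeckePairCongruenceSubgroups` (g38-#1: `(GL_n(F), GL_n(𝒪))` is a Hecke pair with no
topology; finite-index / commensurable subgroups inherit the property) for the level subgroups of the tree's `IwahoriGL`
(`parahoricGL n F c`, `proUnipotentGL n F c`, `iwahoriGL n F`, `proPIwahoriGL n F` — there open compact only over a
non-archimedean LOCAL field) and for the principal congruence subgroups `Γ(a) = Φ(ker(GL_n(𝒪) → GL_n(𝒪/a)))`.

Iwahori–Matsumoto, §3, build the Hecke ring `ℋ(G, B)` of a `p`-adic Chevalley group `G` relative to the Iwahori subgroup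
`B` (the inverse image of a Borel of `G_k` under reduction mod `𝔓`, §2 Prop. 2.4) on the finiteness of `B \ BxB`;
Shimura, §3.1 Prop. 3.1 / §3.2 Lemma 3.10, give the finiteness from commensurability.  Here: every standard parahoric
`P_c = red⁻¹(P_c(𝓀))` and its pro-unipotent radical `U_c = red⁻¹(U_c(𝓀))` have finite index in `GL_n(𝒪)` as soon
as the residue field `𝓀` is finite (`[GL_n(𝒪) : red⁻¹(S)] = [red(GL_n(𝒪)) : S ∩ red(GL_n(𝒪))] ≤ #GL_n(𝓀)`), and
`Γ(a)`, `a ≠ 0`, has finite index because `𝒪/(a)` is finite (g38-#1); so all of them are Hecke subgroups of `GL_n(F)`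
by `isHeckeTriple_top_of_le_of_relIndex_ne_zero` and `isHeckeTriple_glInt_of_finite_residueField` — for every field
`F` whose valuation ring is a DVR with finite residue field, complete or not.

## What is formalised (theorems only; `F` a field with `ValuativeRel F`)

* §1 (`[Finite 𝓀[F]]`) `relIndex_map_subtype_comap_glIntReduction_ne_zero` (`[GL_n(𝒪) : red⁻¹(S)] < ∞` for every
  `S ≤ GL_n(𝓀)`), **`relIndex_parahoricGL_ne_zero`**, **`relIndex_proUnipotentGL_ne_zero`**, `relIndex_iwahoriGL_ne_zero`,
  `relIndex_proPIwahoriGL_ne_zero`.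
* §2 (`[IsDiscreteValuationRing 𝒪[F]] [Finite 𝓀[F]]`) **`isHeckeTriple_parahoricGL`**, **`isHeckeTriple_proUnipotentGL`**,
  **`isHeckeTriple_iwahoriGL`** (Iwahori–Matsumoto's `ℋ(G, B)` is defined), `isHeckeTriple_proPIwahoriGL`,
  **`isHeckeTriple_principalCongruenceGL`** (`Γ(a)`, `a ≠ 0`), `commensurator_iwahoriGL_eq_top`,
  `finite_orbit_quotient_iwahoriGL` («`BxB` is a finite union of cosets `Bx_i`»), `finite_orbit_quotient_parahoricGL`.

## References
* [IwahoriMatsumoto1965] N. Iwahori, H. Matsumoto, *On some Bruhat decomposition and the structure of the Hecke rings of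
  𝔭-adic Chevalley groups*, Publ. Math. IHÉS 25 (1965), §2 Prop. 2.4, §3 (the Hecke ring `ℋ(G, B)`).
* [ShimuraIATAF1971] G. Shimura, *Introduction to the Arithmetic Theory of Automorphic Functions* (1971), §3.1 Prop. 3.1,
  §3.2 Lemma 3.9, Lemma 3.10.
* [AndrianovZhuravlev1995] A. N. Andrianov, V. G. Zhuravlev, *Modular Forms and Hecke Operators* (1995), Ch. 3 §3.1
  Lemma 3.1 (congruence subgroups give Hecke pairs).
-/

open scoped ValuativeRel Pointwise
open ValuativeRel

universe u

namespace Literature.NumberTheory.Automorphic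

variable {n : ℕ} {F : Type u} [Field F] [ValuativeRel F]

/-! ## §1 Finite index of the reduction-defined subgroups of `GL_n(𝒪)` -/

section Index

variable [Finite 𝓀[F]]

/-- **`[GL_n(𝒪) : red⁻¹(S)] < ∞` for every subgroup `S ≤ GL_n(𝓀)` of the finite group `GL_n(𝓀)`** (the subgroup
`red⁻¹(S) ≤ GL_n(𝒪)` read in `GL_n(F)`). [cite: IwahoriMatsumoto1965, §2 Prop. 2.4] [cite: ShimuraIATAF1971, §3.2 Lemma 3.10 (proof)] -/
theorem relIndex_map_subtype_comap_glIntReduction_ne_zero (S : Subgroup (GL (Fin n) 𝓀[F])) :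
    ((S.comap (glIntReduction n F)).map (glInt n F).subtype).relIndex (glInt n F) ≠ 0 := by
  haveI : Finite (GL (Fin n) 𝓀[F]) := by
    haveI : Finite (Matrix (Fin n) (Fin n) 𝓀[F]) := Pi.finite
    infer_instance
  have h : ((S.comap (glIntReduction n F)).map (glInt n F).subtype).relIndex (glInt n F) =
      (S.comap (glIntReduction n F)).index := by
    rw [Subgroup.relIndex, Subgroup.subgroupOf,
      Subgroup.comap_map_eq_self_of_injective (glInt n F).subtype_injective]
  rw [h, Subgroup.index_comap]
  exact (Subgroup.finiteIndex_of_finite (G := (glIntReduction n F).range)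
    (H := S.subgroupOf (glIntReduction n F).range)).index_ne_zero

/-- **Every standard parahoric subgroup has finite index in `GL_n(𝒪)`** (finite residue field).
[cite: IwahoriMatsumoto1965, §2 Prop. 2.4] -/
theorem relIndex_parahoricGL_ne_zero {α : Type*} [LinearOrder α] (c : Fin n → α) :
    (parahoricGL n F c).relIndex (glInt n F) ≠ 0 :=
  relIndex_map_subtype_comap_glIntReduction_ne_zero _

/-- **The pro-unipotent radical of a standard parahoric has finite index in `GL_n(𝒪)`** (finite residue field).
[cite: IwahoriMatsumoto1965, §2 Prop. 2.4] -/
theorem relIndex_proUnipotentGL_ne_zero {α : Type*} [LinearOrder α] (c : Fin n → α) :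
    (proUnipotentGL n F c).relIndex (glInt n F) ≠ 0 :=
  relIndex_map_subtype_comap_glIntReduction_ne_zero _

/-- The Iwahori subgroup has finite index in `GL_n(𝒪)` (finite residue field).
[cite: IwahoriMatsumoto1965, §2 Prop. 2.4, Thm. 2.5] -/
theorem relIndex_iwahoriGL_ne_zero : (iwahoriGL n F).relIndex (glInt n F) ≠ 0 :=
  relIndex_parahoricGL_ne_zero _

/-- The pro-`p` Iwahori subgroup has finite index in `GL_n(𝒪)` (finite residue field). [cite: IwahoriMatsumoto1965, §2 Prop. 2.4] -/
theorem relIndex_proPIwahoriGL_ne_zero : (proPIwahoriGL n F).relIndex (glInt n F) ≠ 0 :=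
  relIndex_proUnipotentGL_ne_zero _

end Index

/-! ## §2 The Hecke pairs -/

section HeckePairs

variable [IsDiscreteValuationRing 𝒪[F]] [Finite 𝓀[F]]

/-- **`(GL_n(F), P_c)` is a Hecke pair for every standard parahoric subgroup** — no compactness, `F` any field whose
valuation ring is a DVR with finite residue field. [cite: IwahoriMatsumoto1965, §3] [cite: ShimuraIATAF1971, §3.2 Lemma 3.10] -/
theorem isHeckeTriple_parahoricGL {α : Type*} [LinearOrder α] (c : Fin n → α) :
    IsHeckeTriple (⊤ : Submonoid (GL (Fin n) F)) (parahoricGL n F c) (parahoricGL n F c) :=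
  haveI := isHeckeTriple_glInt_of_finite_residueField (F := F) n
  isHeckeTriple_top_of_le_of_relIndex_ne_zero (parahoricGL_le_glInt n F c) (relIndex_parahoricGL_ne_zero c)

/-- **`(GL_n(F), U_c)` is a Hecke pair for the pro-unipotent radical of every standard parahoric** (in particular for
the first congruence subgroup `K₁ = 1 + 𝓂 M_n(𝒪)`, `c` constant). [cite: IwahoriMatsumoto1965, §3]
[cite: ShimuraIATAF1971, §3.2 Lemma 3.10] -/
theorem isHeckeTriple_proUnipotentGL {α : Type*} [LinearOrder α] (c : Fin n → α) :
    IsHeckeTriple (⊤ : Submonoid (GL (Fin n) F)) (proUnipotentGL n F c) (proUnipotentGL n F c) :=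
  haveI := isHeckeTriple_glInt_of_finite_residueField (F := F) n
  isHeckeTriple_top_of_le_of_relIndex_ne_zero (proUnipotentGL_le_glInt n F c) (relIndex_proUnipotentGL_ne_zero c)

/-- **`(GL_n(F), I)` IS A HECKE PAIR FOR THE IWAHORI SUBGROUP** — the Iwahori–Hecke ring `ℋ(G, B)` of Iwahori–Matsumoto
is defined over every field whose valuation ring is a DVR with finite residue field.
[cite: IwahoriMatsumoto1965, §3] [cite: ShimuraIATAF1971, §3.1 Prop. 3.1] -/
theorem isHeckeTriple_iwahoriGL :
    IsHeckeTriple (⊤ : Submonoid (GL (Fin n) F)) (iwahoriGL n F) (iwahoriGL n F) :=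
  isHeckeTriple_parahoricGL _

/-- `(GL_n(F), I₁)` is a Hecke pair for the pro-`p` Iwahori subgroup. [cite: IwahoriMatsumoto1965, §3]
[cite: ShimuraIATAF1971, §3.1 Prop. 3.1] -/
theorem isHeckeTriple_proPIwahoriGL :
    IsHeckeTriple (⊤ : Submonoid (GL (Fin n) F)) (proPIwahoriGL n F) (proPIwahoriGL n F) :=
  isHeckeTriple_proUnipotentGL _

/-- **`(GL_n(F), Γ(a))` is a Hecke pair for every principal congruence subgroup** `Γ(a) = Φ(ker(GL_n(𝒪) → GL_n(𝒪/a)))`,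
`a ≠ 0` (`𝒪/(a)` is finite: g38-#1 `finite_quotient_span_of_ne_zero`, `relIndex_map_ker_range_ne_zero`).
[cite: ShimuraIATAF1971, §3.2 Lemma 3.9, Lemma 3.10] [cite: AndrianovZhuravlev1995, Ch. 3 §3.1 Lemma 3.1] -/
theorem isHeckeTriple_principalCongruenceGL {a : 𝒪[F]} (ha : a ≠ 0) :
    IsHeckeTriple (⊤ : Submonoid (GL (Fin n) F))
      (((Matrix.GeneralLinearGroup.map (n := Fin n) (Ideal.Quotient.mk (Ideal.span {a}))).ker).map
        (Matrix.GeneralLinearGroup.map (𝒪[F]).subtype))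
      (((Matrix.GeneralLinearGroup.map (n := Fin n) (Ideal.Quotient.mk (Ideal.span {a}))).ker).map
        (Matrix.GeneralLinearGroup.map (𝒪[F]).subtype)) := by
  haveI := isHeckeTriple_glInt_of_finite_residueField (F := F) n
  haveI := finite_quotient_span_of_ne_zero (F := F) ha
  refine isHeckeTriple_top_of_le_of_relIndex_ne_zero (K := glInt n F) ?_
    (relIndex_map_ker_range_ne_zero (𝒪[F]).subtype Subtype.val_injective a)
  rintro _ ⟨u, -, rfl⟩
  exact ⟨u, rfl⟩

/-- The commensurator of the Iwahori subgroup in `GL_n(F)` is all of `GL_n(F)`. [cite: ShimuraIATAF1971, §3.1, §3.2 Lemma 3.10] -/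
theorem commensurator_iwahoriGL_eq_top :
    Subgroup.Commensurable.commensurator (iwahoriGL n F) = ⊤ :=
  haveI := isHeckeTriple_iwahoriGL (n := n) (F := F)
  commensurator_eq_top _

/-- **Every double coset `I x I` is a finite union of cosets `I x_i`** («`BxB = ⋃ B x_i`»).
[cite: IwahoriMatsumoto1965, §3] [cite: ShimuraIATAF1971, §3.1 Prop. 3.1] -/
theorem finite_orbit_quotient_iwahoriGL (g : GL (Fin n) F) :
    (MulAction.orbit (iwahoriGL n F) (g : GL (Fin n) F ⧸ iwahoriGL n F)).Finite :=
  haveI := isHeckeTriple_iwahoriGL (n := n) (F := F)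
  finite_orbit_quotient _ g

/-- Every double coset `P_c x P_c` of a standard parahoric is a finite union of left cosets.
[cite: IwahoriMatsumoto1965, §3] [cite: ShimuraIATAF1971, §3.1 Prop. 3.1] -/
theorem finite_orbit_quotient_parahoricGL {α : Type*} [LinearOrder α] (c : Fin n → α) (g : GL (Fin n) F) :
    (MulAction.orbit (parahoricGL n F c) (g : GL (Fin n) F ⧸ parahoricGL n F c)).Finite :=
  haveI := isHeckeTriple_parahoricGL (n := n) (F := F) c
  finite_orbit_quotient _ g

end HeckePairs

end Literature.NumberTheory.Automorphic
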